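import Mathlib
import HarnessLib
import Literature.Combinatorics.Additive.KempermanNearSequences

/-!
# The minimal-counterexample analysis of Kemperman's structure theorem
# (Boothby–DeVos–Montejano §8: Claims 7–12 and the final step; the one-step theorem for trivial stabiliser)

[cite: BoothbyDevosMontejano2013, §8; Thm 4.5] [cite: Grynkiewicz2013, Ch. 9] [tag: critical-pair]
[tag: inverse-theorem]

Kemperman's structure theorem (Theorem 4.5 of the paper) says, recursively, that every maximal
nontrivial critical trio `(A,B,C)` of an abelian group is a pure beat, a pure chord, an impure beat or
an impure chord relative to some proper subgroup `H` (the four notions of §4 are in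
`KempermanStructures.lean`, similarity-closed: `IsPureBeat`, `IsPureChord`, `IsImpureBeat`,
`IsImpureChord`), the impure cases continuing inside `H`.  Section 8 proves it by analysing a minimal
counterexample, minimal for (1) `|G|`, (2) `|G ∖ C|` where `|A| ≤ |B| ≤ |C|`, (3) the number of members
with closure `G` (criterion (3) is used only for infinite groups).  This file formalizes, for FINITE
abelian groups, everything in that analysis except the passage to the quotient `G / stab(A)`
(Claim 6), and packages it as the ONE-STEP THEOREM FOR TRIVIAL STABILISER:

* `kemperman_step_of_addStab_eq_singleton`: if `(A,B,C)` is a maximal nontrivial critical trio with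
  `|A| ≤ |B| ≤ |C|` and `stab(A) = {0}`, and the step conclusion is known for every maximal nontrivial
  critical trio of `G` whose third member is larger than `|C|` (`StepBelow C`, criterion (2)), then
  `(A,B,C)` is a pure beat, pure chord, impure beat or impure chord relative to a proper subgroup
  carrier `H` — PROVED.

The individual steps, all PROVED, with the hypotheses of the minimal counterexample made explicit
(`InNoProperCoset X` = "`[X] = G`", the outcome of Claim 7; `NoProperNearSeq A`, the outcome of
Claim 8; `3|A| ≤ |G| + 1`, which is `δ = 1` (Claim 6 with Theorem 3.5: `δ = |stab|`) plus the ordering):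
* Claim 7 (tool) `IsMaximalTrio.isPureBeat_or_isImpureBeat_of_subset_coset`: a member inside a coset
  of its closure ⇒ pure or impure beat (Lemma 5.3 = `IsMaximalTrio.isPureBeatAt_or_isImpureBeat`
  after a translation); the similarity lemmas `Similar.trans/symm`, `IsPureBeat.similar` (and the
  three others), `Similar.exists_subset_coset`, `IsPureBeat/IsImpureBeat.exists_subset_coset` (a beat
  has a member in an `H`-coset) and `ClosureIs.vadd`.
* Claim 8 (tool) `IsMaximalTrio.isPureChord_or_isImpureChord_of_isNearSeq`: Lemma 7.5
  (`isPureChord_or_isImpureChord_of_near`) for `A` in arbitrary position.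
* The two-coset argument `false_of_subset_two_cosets` ("`A` contains points in exactly two
  `H`-cosets, but then `A` is a near `R`-sequence for some `R`"): we supply the two facts the text
  leaves implicit — `R = (a₂ − a₁) + H` generates `G/H` because otherwise `A` lies in a coset of the
  proper subgroup `⟨H, R⟩` (`isSubgroupCarrier_rseq_period`), and the near sequence is PROPER
  (`2|H| ≤ |G ∖ A|`) because `3|A| ≤ |G| + 1` and `|A| > |H|` force `[G : H] ≥ 4`.
* Claim 9 `inNoProperCoset_of_critical`; Claim 10 `not_critical_subgroup` (with
  `two_mul_card_lt_of_critical`); Claim 11 `setDeficiency_le_one` (via Mann's Theorem 6.1 =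
  `exists_subgroupCarrier_setDeficiency_eq`) and `inNoProperCoset_of_critical_of_two_le` (via
  Lemma 5.2 = `card_add_card_add_le_of_critical`); Claim 12 `exists_two_le_card_inter_vadd` ("`B` is
  not a Sidon set"); the common end of Claim 10 and of the final step `false_of_structure_supertrio`
  (a chord supertrio makes `A` a proper near sequence by Lemma 7.6; a beat supertrio puts a member in
  a proper coset).
* The final doubling step (`B' = B ∩ (g + B)`, `C' = C ∪ (C − g)`, `B'' = B ∪ (g + B)`,
  `C'' = C ∩ (C − g)`, `δ' + δ'' = 2δ` = `trioDeficiency_union_inter_add`) is inside the proof of the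
  step theorem; "`(A,B',C')` maximal" is not needed — Lemma 7.6 is applied to `(A,B',C')` as a
  subtrio of a maximal supertrio (`IsTrio.exists_maximal`), exactly as in Claim 10.

NOT FORMALIZED: Claim 6 / Theorem 4.5 itself — the passage to `G / stab(A)` when the stabiliser is
nontrivial and the lifting of the four structures back to `G`, an induction over all finite abelian
groups (see the cell blueprint).  With that transport, Theorem 4.5 (one step) follows from
`kemperman_step_of_addStab_eq_singleton` by induction on `|G ∖ C|`, and the printed chain by recursion
on the continuations of `KempermanStructures.lean`.  Everything here is PROVED (0 named facts).

Setting: `G` a finite additive commutative group, subsets as `Finset`s, subgroups as carriers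
`IsSubgroupCarrier H` (as in `CriticalTrios.lean`).

## References
* T. Boothby, M. DeVos, A. Montejano, *A new proof of Kemperman's theorem*, arXiv:1301.0095 (2013);
  INTEGERS 15 (2015) #A5 — §8 (proof of Theorem 4.5), held `paper:arxiv-1301.0095`, chunks
  p0011–p0012 read 2026-08-28 [cite: BoothbyDevosMontejano2013, §8 Claims 6–12].
* D. J. Grynkiewicz, *Structural Additive Theory*, Springer (2013), Ch. 9 [cite: Grynkiewicz2013, Ch. 9].
-/

namespace Literature.Combinatorics.Additive

open Finset Grynkiewicz
open scoped Pointwise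

variable {G : Type*} [AddCommGroup G] [DecidableEq G]

/-! ## More on similarity -/

section SimilarMore

variable {T U V : Finset G × Finset G × Finset G} {A B C : Finset G}

omit [DecidableEq G] in
/-- Similarity is transitive. [cite: BoothbyDevosMontejano2013, §4] -/
theorem Similar.trans [DecidableEq G] (h₁ : Similar T U) (h₂ : Similar U V) : Similar T V := by
  induction h₂ with
  | refl => exact h₁
  | rotate _ ih => exact ih.rotate
  | swap _ ih => exact ih.swap
  | translate g _ ih => exact ih.translate g

omit [DecidableEq G] in
/-- Similarity is symmetric (each move is invertible). [cite: BoothbyDevosMontejano2013, §4] -/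
theorem Similar.symm [DecidableEq G] (h : Similar T U) : Similar U T := by
  induction h with
  | refl => exact Similar.refl _
  | @rotate A B C _ ih => exact ((Similar.refl (B, C, A)).rotate.rotate).trans ih
  | @swap A B C _ ih => exact ((Similar.refl (B, A, C)).swap).trans ih
  | @translate A B C g _ ih =>
    have := (Similar.refl (g +ᵥ A, -g +ᵥ B, C)).translate (-g)
    rw [neg_vadd_vadd, neg_neg, vadd_neg_vadd] at this
    exact this.trans ih

variable [Fintype G] {H : Finset G}

/-- Pure beats are similarity-closed. [cite: BoothbyDevosMontejano2013, Def 4.1] -/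
theorem IsPureBeat.similar (h : IsPureBeat H U) (hUV : Similar U V) : IsPureBeat H V := by
  obtain ⟨A, B, C, h, hs⟩ := h; exact ⟨A, B, C, h, hs.trans hUV⟩

/-- Pure chords are similarity-closed. [cite: BoothbyDevosMontejano2013, Def 4.2] -/
theorem IsPureChord.similar (h : IsPureChord H U) (hUV : Similar U V) : IsPureChord H V := by
  obtain ⟨r, A, B, C, h, hs⟩ := h; exact ⟨r, A, B, C, h, hs.trans hUV⟩

/-- Impure beats are similarity-closed. [cite: BoothbyDevosMontejano2013, Def 4.3] -/
theorem IsImpureBeat.similar (h : IsImpureBeat H U) (hUV : Similar U V) : IsImpureBeat H V := by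
  obtain ⟨A, B, C, h, hs⟩ := h; exact ⟨A, B, C, h, hs.trans hUV⟩

/-- Impure chords are similarity-closed. [cite: BoothbyDevosMontejano2013, Def 4.4] -/
theorem IsImpureChord.similar (h : IsImpureChord H U) (hUV : Similar U V) : IsImpureChord H V := by
  obtain ⟨r, A, B, C, h, hs⟩ := h; exact ⟨r, A, B, C, h, hs.trans hUV⟩

omit [Fintype G] in
/-- A triple one of whose members lies in an `H`-coset keeps this property under similarity.
[cite: BoothbyDevosMontejano2013, §8 (Claim 7)] -/
theorem Similar.exists_subset_coset (hTU : Similar T U)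
    (hT : ∃ x : G, T.1 ⊆ x +ᵥ H ∨ T.2.1 ⊆ x +ᵥ H ∨ T.2.2 ⊆ x +ᵥ H) :
    ∃ x : G, U.1 ⊆ x +ᵥ H ∨ U.2.1 ⊆ x +ᵥ H ∨ U.2.2 ⊆ x +ᵥ H := by
  induction hTU with
  | refl => exact hT
  | rotate _ ih =>
    obtain ⟨x, h | h | h⟩ := ih
    · exact ⟨x, Or.inr (Or.inr h)⟩
    · exact ⟨x, Or.inl h⟩
    · exact ⟨x, Or.inr (Or.inl h)⟩
  | swap _ ih =>
    obtain ⟨x, h | h | h⟩ := ih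
    · exact ⟨x, Or.inr (Or.inl h)⟩
    · exact ⟨x, Or.inl h⟩
    · exact ⟨x, Or.inr (Or.inr h)⟩
  | translate g _ ih =>
    obtain ⟨x, h | h | h⟩ := ih
    · refine ⟨g + x, Or.inl ?_⟩
      have := vadd_finset_subset_vadd_finset (a := g) h
      rwa [vadd_vadd] at this
    · refine ⟨-g + x, Or.inr (Or.inl ?_)⟩
      have := vadd_finset_subset_vadd_finset (a := -g) h
      rwa [vadd_vadd] at this
    · exact ⟨x, Or.inr (Or.inr h)⟩

/-- A pure beat relative to `H` has a member inside an `H`-coset. [cite: BoothbyDevosMontejano2013, Def 4.1] -/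
theorem IsPureBeat.exists_subset_coset (h : IsPureBeat H (A, B, C)) :
    ∃ x : G, A ⊆ x +ᵥ H ∨ B ⊆ x +ᵥ H ∨ C ⊆ x +ᵥ H := by
  obtain ⟨A₀, B₀, C₀, h₀, hs⟩ := h
  exact hs.exists_subset_coset ⟨0, Or.inl (by rw [h₀.1, zero_vadd])⟩

/-- An impure beat relative to `H` has a member inside an `H`-coset. [cite: BoothbyDevosMontejano2013, Def 4.3] -/
theorem IsImpureBeat.exists_subset_coset (h : IsImpureBeat H (A, B, C)) :
    ∃ x : G, A ⊆ x +ᵥ H ∨ B ⊆ x +ᵥ H ∨ C ⊆ x +ᵥ H := by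
  obtain ⟨A₀, B₀, C₀, h₀, hs⟩ := h
  exact hs.exists_subset_coset ⟨0, Or.inl (by rw [zero_vadd]; exact h₀.1)⟩

end SimilarMore

/-! ## Closures -/

section Closure

variable [Fintype G] {H A : Finset G}

omit [Fintype G] in
/-- Closures are translation invariant. [cite: BoothbyDevosMontejano2013, §4] -/
theorem ClosureIs.vadd (hcl : ClosureIs H A) (g : G) : ClosureIs H (g +ᵥ A) := by
  obtain ⟨⟨a, ha⟩, hmin⟩ := hcl
  refine ⟨⟨g + a, by rw [add_vadd]; exact vadd_finset_subset_vadd_finset ha⟩,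
    fun K hK hKH ⟨b, hb⟩ => hmin hK hKH ⟨-g + b, ?_⟩⟩
  have := vadd_finset_subset_vadd_finset (a := -g) hb
  rwa [neg_vadd_vadd, vadd_vadd] at this

end Closure

/-! ## Claim 7: a member inside a proper coset makes the trio a beat -/

section Claim7

variable [Fintype G] {H A B C : Finset G}

/-- **Claim 7 (tool).**  A maximal nontrivial critical trio whose first member lies in a coset of
its closure subgroup `H` is a pure beat or an impure beat relative to `H` (Lemma 5.3 after the
translation `(A − x, B + x, C)`). [cite: BoothbyDevosMontejano2013, §8 (Claim 7); Lemma 5.3] -/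
theorem IsMaximalTrio.isPureBeat_or_isImpureBeat_of_subset_coset (hmax : IsMaximalTrio A B C)
    (hδ : 0 < trioDeficiency A B C) (hA : A.Nonempty) (hB : B.Nonempty) (hC : C.Nonempty)
    (hH : IsSubgroupCarrier H) (hcl : ClosureIs H A) {x : G} (hAx : A ⊆ x +ᵥ H) :
    IsPureBeat H (A, B, C) ∨ IsImpureBeat H (A, B, C) := by
  have hsim : Similar (A, B, C) ((-x) +ᵥ A, x +ᵥ B, C) := by
    have := (Similar.refl (A, B, C)).translate (-x)
    rwa [neg_neg] at this
  have hmax' := hsim.isMaximalTrio_iff.1 hmax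
  have hδ' : 0 < trioDeficiency ((-x) +ᵥ A) (x +ᵥ B) C := by rwa [← hsim.trioDeficiency_eq]
  have hA'H : (-x) +ᵥ A ⊆ H := by
    have := vadd_finset_subset_vadd_finset (a := -x) hAx
    rwa [neg_vadd_vadd] at this
  rcases hmax'.isPureBeatAt_or_isImpureBeat hδ' (hA.vadd_finset) (hB.vadd_finset) hC hH
    (hcl.vadd (-x)) hA'H with h | h
  · exact Or.inl ⟨_, _, _, h, hsim.symm⟩
  · exact Or.inr (h.similar hsim.symm)

end Claim7

/-! ## Claim 8: a proper near sequence makes the trio a chord -/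

section Claim8

variable [Fintype G] {H A B C : Finset G} {r : G}

/-- **Claim 8 (tool)** = Lemma 7.5 for `A` in arbitrary position: if `A` is a nontrivial proper near
`R`-sequence and `B`, `C` lie in no `H`-coset, the maximal critical trio `(A,B,C)` is a pure or impure
chord relative to `H`. [cite: BoothbyDevosMontejano2013, §8 (Claim 8); Lemma 7.5] -/
theorem IsMaximalTrio.isPureChord_or_isImpureChord_of_isNearSeq (hH : IsSubgroupCarrier H)
    (hgen : IsCyclicQuotGen H r) (hAn : IsNearSeq H r A) (hHA : #H < #A) (hproper : 2 * #H ≤ #Aᶜ)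
    (hmax : IsMaximalTrio A B C) (hδ : 0 < trioDeficiency A B C) (hBc : ∀ c : G, ¬ B ⊆ c +ᵥ H)
    (hCc : ∀ c : G, ¬ C ⊆ c +ᵥ H) : IsPureChord H (A, B, C) ∨ IsImpureChord H (A, B, C) := by
  obtain ⟨t, ht, htH, hmin⟩ := exists_minimal_nsmul_mem hH r
  obtain ⟨⟨a, n, hn, hAH⟩, hnear⟩ := hAn
  have hn2 : 2 ≤ n := by
    by_contra hlt
    have h1 : n = 1 := by omega
    rw [h1, rseq_one] at hAH
    have := card_le_card (hH.subset_add A)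
    rw [hAH, card_vadd_finset] at this
    omega
  obtain ⟨ℓ, rfl⟩ : ∃ ℓ, n = ℓ + 1 := ⟨n - 1, by omega⟩
  have hsim : Similar (A, B, C) ((-a) +ᵥ A, a +ᵥ B, C) := by
    have := (Similar.refl (A, B, C)).translate (-a)
    rwa [neg_neg] at this
  have hmax' := hsim.isMaximalTrio_iff.1 hmax
  have hδ' : 0 < trioDeficiency ((-a) +ᵥ A) (a +ᵥ B) C := by rwa [← hsim.trioDeficiency_eq]
  have hA'H : ((-a) +ᵥ A) + H = rseq H r 0 (ℓ + 1) := by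
    rw [vadd_add_assoc, hAH, vadd_rseq, neg_add_cancel]
  have hnear' : #((((-a) +ᵥ A) + H) \ ((-a) +ᵥ A)) < #H := by
    rw [vadd_add_assoc, ← vadd_finset_sdiff, card_vadd_finset]; exact hnear
  have hproper' : 2 * #H ≤ #((-a) +ᵥ A)ᶜ := by
    rw [card_compl, card_vadd_finset, ← card_compl]; exact hproper
  have hB'c : ∀ c : G, ¬ a +ᵥ B ⊆ c +ᵥ H := by
    intro c h
    apply hBc (-a + c)
    have := vadd_finset_subset_vadd_finset (a := -a) h
    rwa [neg_vadd_vadd, vadd_vadd] at this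
  rcases isPureChord_or_isImpureChord_of_near hH hgen ht htH hmin hA'H hnear' (by omega) hproper'
    hmax' hδ' hB'c hCc with h | h
  · exact Or.inl (h.similar hsim.symm)
  · exact Or.inr (h.similar hsim.symm)

end Claim8

/-! ## Claim 12: `B` is not a Sidon set -/

section Claim12

variable {A B : Finset G}

/-- **Claim 12.**  "`B` is not a Sidon set: `|(g + B) ∩ B| > 1` for some `g ∈ G ∖ {0}`" — for a
critical pair `(A,B)` with `3 ≤ |A| ≤ |B|` (three translates `aᵢ + B` pairwise meeting in at most one
point would give `|A + B| ≥ 3|B| − 3 ≥ |A| + |B|`). [cite: BoothbyDevosMontejano2013, §8 (Claim 12)] -/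
theorem exists_two_le_card_inter_vadd (hcrit : #(A + B) < #A + #B) (hA3 : 3 ≤ #A) (hAB : #A ≤ #B) :
    ∃ g : G, g ≠ 0 ∧ 2 ≤ #(B ∩ (g +ᵥ B)) := by
  by_contra hno
  push Not at hno
  have hsid : ∀ a a' : G, a ≠ a' → #((a +ᵥ B) ∩ (a' +ᵥ B)) ≤ 1 := by
    intro a a' hne
    have e : (a +ᵥ B) ∩ (a' +ᵥ B) = a +ᵥ (B ∩ ((-a + a') +ᵥ B)) := by
      rw [vadd_finset_inter, vadd_vadd, add_neg_cancel_left]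
    rw [e, card_vadd_finset]
    have := hno (-a + a') (fun h => hne (neg_add_eq_zero.1 h))
    omega
  -- three distinct elements of `A`
  obtain ⟨a₁, ha₁, a₂, ha₂, a₃, ha₃, h12, h13, h23⟩ : ∃ a₁ ∈ A, ∃ a₂ ∈ A, ∃ a₃ ∈ A,
      a₁ ≠ a₂ ∧ a₁ ≠ a₃ ∧ a₂ ≠ a₃ := by
    rw [show 3 = 2 + 1 from rfl] at hA3
    obtain ⟨s, hs, hs3⟩ := exists_subset_card_eq hA3
    obtain ⟨a₁, a₂, a₃, h12, h13, h23, hs'⟩ := card_eq_three.1 hs3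
    refine ⟨a₁, hs (by rw [hs']; simp), a₂, hs (by rw [hs']; simp), a₃, hs (by rw [hs']; simp),
      h12, h13, h23⟩
  have hsub : (a₁ +ᵥ B) ∪ (a₂ +ᵥ B) ∪ (a₃ +ᵥ B) ⊆ A + B :=
    union_subset (union_subset (vadd_finset_subset_add ha₁) (vadd_finset_subset_add ha₂))
      (vadd_finset_subset_add ha₃)
  have h1 := card_le_card hsub
  have hu1 := card_union_add_card_inter (a₁ +ᵥ B) (a₂ +ᵥ B)
  have hu2 := card_union_add_card_inter ((a₁ +ᵥ B) ∪ (a₂ +ᵥ B)) (a₃ +ᵥ B)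
  have hi3 : #(((a₁ +ᵥ B) ∪ (a₂ +ᵥ B)) ∩ (a₃ +ᵥ B)) ≤ 2 := by
    rw [union_inter_distrib_right]
    have := card_union_le ((a₁ +ᵥ B) ∩ (a₃ +ᵥ B)) ((a₂ +ᵥ B) ∩ (a₃ +ᵥ B))
    have := hsid a₁ a₃ h13
    have := hsid a₂ a₃ h23
    omega
  have := hsid a₁ a₂ h12
  simp only [card_vadd_finset] at hu1 hu2
  omega

end Claim12

/-! ## The standing hypotheses of §8 after Claims 6–8, and their first consequences -/

section Standing

variable [Fintype G] {H A B C D : Finset G} {r : G}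

/-- "`[X] = G`": `X` lies in no coset of a proper subgroup (the conclusion of Claim 7 for each
member of the minimal counterexample). [cite: BoothbyDevosMontejano2013, §8 (Claim 7)] -/
def InNoProperCoset (X : Finset G) : Prop :=
  ∀ (H : Finset G) (x : G), IsSubgroupCarrier H → H ≠ univ → ¬ X ⊆ x +ᵥ H

/-- "`A` is not a (nontrivial) proper near sequence" for any proper `H < G` with `G/H` cyclic
(the conclusion of Claim 8). [cite: BoothbyDevosMontejano2013, §8 (Claim 8)] -/
def NoProperNearSeq (A : Finset G) : Prop :=
  ∀ (H : Finset G) (r : G), IsSubgroupCarrier H → H ≠ univ → IsCyclicQuotGen H r →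
    IsNearSeq H r A → #H < #A → 2 * #H ≤ #Aᶜ → False

/-- Unfolding lemma. [cite: BoothbyDevosMontejano2013, §8 (Claim 7)] -/
theorem inNoProperCoset_iff {X : Finset G} : InNoProperCoset X ↔
    ∀ (H : Finset G) (x : G), IsSubgroupCarrier H → H ≠ univ → ¬ X ⊆ x +ᵥ H := Iff.rfl

/-- Unfolding lemma. [cite: BoothbyDevosMontejano2013, §8 (Claim 8)] -/
theorem noProperNearSeq_iff : NoProperNearSeq A ↔
    ∀ (H : Finset G) (r : G), IsSubgroupCarrier H → H ≠ univ → IsCyclicQuotGen H r →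
      IsNearSeq H r A → #H < #A → 2 * #H ≤ #Aᶜ → False := Iff.rfl

/-- Supersets inherit "in no proper coset". [cite: BoothbyDevosMontejano2013, §8] -/
theorem InNoProperCoset.mono {X Y : Finset G} (h : InNoProperCoset X) (hXY : X ⊆ Y) :
    InNoProperCoset Y := fun H x hH hHu hY => h H x hH hHu (hXY.trans hY)

/-- A generator `r + H` of `G/H` with `H ≠ G` is not in `H`. [cite: BoothbyDevosMontejano2013, §4] -/
theorem not_mem_of_isCyclicQuotGen (hH : IsSubgroupCarrier H) (hHu : H ≠ univ)
    (hgen : IsCyclicQuotGen H r) : r ∉ H := by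
  intro hr
  apply hHu
  refine eq_univ_of_forall fun x => ?_
  obtain ⟨i, hi⟩ := hgen x
  rw [hH.mem_coset_iff] at hi
  have hr1 : 1 • r ∈ H := by rwa [one_nsmul]
  have := hH.add_mem hi (hH.mul_nsmul_mem hr1 i)
  rwa [one_mul, sub_add_cancel] at this

/-- A near `R`-sequence lying in no proper coset meets at least two cosets, so `|A| > |H|`.
[cite: BoothbyDevosMontejano2013, §8] -/
theorem card_lt_of_isNearSeq (hH : IsSubgroupCarrier H) (hHu : H ≠ univ) (hgen : IsCyclicQuotGen H r)
    (hA : IsNearSeq H r A) (h7 : InNoProperCoset A) : #H < #A := by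
  obtain ⟨⟨a, n, hn, hAH⟩, hnear⟩ := hA
  have hn2 : 2 ≤ n := by
    by_contra h
    have h1 : n = 1 := by omega
    rw [h1, rseq_one] at hAH
    exact h7 H a hH hHu (by rw [← hAH]; exact hH.subset_add A)
  have hr : r ∉ H := not_mem_of_isCyclicQuotGen hH hHu hgen
  -- the first two cosets of the hull are distinct
  have hsub : (a +ᵥ H) ∪ ((a + r) +ᵥ H) ⊆ A + H := by
    rw [hAH]
    refine union_subset ?_ ?_
    · have := coset_subset_rseq H r a (i := 0) (n := n) (by omega)
      rwa [zero_nsmul, add_zero] at this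
    · have := coset_subset_rseq H r a (i := 1) (n := n) (by omega)
      rwa [one_nsmul] at this
  have hdis : Disjoint (a +ᵥ H) ((a + r) +ᵥ H) := by
    rcases hH.coset_eq_or_disjoint a (a + r) with he | hd
    · exfalso; apply hr
      have : a + r ∈ a +ᵥ H := by rw [he]; exact hH.mem_coset_self _
      rw [hH.mem_coset_iff, add_sub_cancel_left] at this; exact this
    · exact hd
  have h1 := card_le_card hsub
  rw [card_union_of_disjoint hdis, card_vadd_finset, card_vadd_finset] at h1
  have h2 := card_sdiff_add_card_eq_card (hH.subset_add A)
  omega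

omit [Fintype G] in
/-- The subgroup carrier generated by `H` and `r`: `⋃_{i<t} (i r + H)` for the period `t` of `r`.
[cite: BoothbyDevosMontejano2013, §8 (Claim 9)] -/
theorem isSubgroupCarrier_rseq_period (hH : IsSubgroupCarrier H) {t : ℕ} (ht : 0 < t)
    (htH : t • r ∈ H) : IsSubgroupCarrier (rseq H r 0 t) := by
  refine ⟨coset_subset_rseq H r 0 (i := 0) ht (by rw [zero_add, zero_nsmul]; exact hH.mem_coset_self 0), ?_⟩
  intro x hx y hy
  rw [mem_rseq] at hx hy ⊢
  obtain ⟨i, hi, hxi⟩ := hx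
  obtain ⟨j, hj, hyj⟩ := hy
  rw [zero_add] at hxi hyj
  refine ⟨(i + (t - j)) % t, Nat.mod_lt _ ht, ?_⟩
  rw [zero_add, hH.mem_coset_iff] at *
  set q := (i + (t - j)) / t with hq
  have e1 : ((i + (t - j)) % t) • r + (t * q) • r = (i + (t - j)) • r := by
    rw [← add_nsmul, Nat.mod_add_div]
  have e2 : (t - j) • r + j • r = t • r := by rw [← add_nsmul, Nat.sub_add_cancel hj.le]
  have e : x - y - ((i + (t - j)) % t) • r =
      (x - i • r) - (y - j • r) - t • r + (t * q) • r := by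
    have : ((i + (t - j)) % t) • r = (i + (t - j)) • r - (t * q) • r := by rw [← e1]; abel
    rw [this, add_nsmul, ← e2]; abel
  rw [e]
  exact hH.add_mem (hH.sub_mem (hH.sub_mem hxi hyj) htH) (hH.mul_nsmul_mem htH q)

/-- THE TWO-COSET ARGUMENT (used in Claims 9, 10 and 12): if `A` lies in two `H`-cosets
`a₁ + H ≠ a₂ + H`, meets both, has `|A| > |H|`, lies in no proper coset and `3|A| ≤ |G| + 1`, then
`A` is a nontrivial proper near `R`-sequence for `R = (a₂ − a₁) + H` (which generates `G/H`, since
otherwise `A` lies in a proper coset) — contradicting `NoProperNearSeq A`.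
[cite: BoothbyDevosMontejano2013, §8 (Claims 9, 10)] -/
theorem false_of_subset_two_cosets (hH : IsSubgroupCarrier H) (hHu : H ≠ univ) {a₁ a₂ : G}
    (ha₁ : a₁ ∈ A) (ha₂ : a₂ ∈ A) (hne : a₂ ∉ a₁ +ᵥ H) (hAsub : A ⊆ (a₁ +ᵥ H) ∪ (a₂ +ᵥ H))
    (hHA : #H < #A) (hAle : 3 * #A ≤ Fintype.card G + 1) (h7 : InNoProperCoset A)
    (h8 : NoProperNearSeq A) : False := by
  set r := a₂ - a₁ with hr
  obtain ⟨t, ht, htH, hmin⟩ := exists_minimal_nsmul_mem hH r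
  have hHpos := hH.nonempty.card_pos
  have ha₂' : a₂ = a₁ + r := by rw [hr]; abel
  -- the subgroup `K` generated by `H` and `r` contains `A − a₁`, hence is all of `G`
  have hK := isSubgroupCarrier_rseq_period hH ht htH
  have hAK : A ⊆ a₁ +ᵥ rseq H r 0 t := by
    have ht2 : 2 ≤ t := by
      by_contra h
      have : t = 1 := by omega
      rw [this, one_nsmul] at htH
      exact hne (by rw [hH.mem_coset_iff, ← hr]; exact htH)
    intro a ha
    rw [vadd_rseq, add_zero]
    rcases mem_union.1 (hAsub ha) with h | h
    · have := coset_subset_rseq H r a₁ (i := 0) (n := t) ht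
      rw [zero_nsmul, add_zero] at this; exact this h
    · have := coset_subset_rseq H r a₁ (i := 1) (n := t) ht2
      rw [one_nsmul, ← ha₂'] at this; exact this h
  have hKu : rseq H r 0 t = univ := by
    by_contra hKu; exact h7 _ a₁ hK hKu hAK
  have hgen : IsCyclicQuotGen H r := by
    intro x
    have hx : x ∈ rseq H r 0 t := by rw [hKu]; exact mem_univ x
    rw [mem_rseq] at hx
    obtain ⟨i, -, hxi⟩ := hx
    exact ⟨i, by rwa [zero_add] at hxi⟩
  -- `A` is a near `R`-sequence with hull `a₁ + [0,2)R`
  have hAH : A + H = rseq H r a₁ 2 := by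
    refine Subset.antisymm ?_ ?_
    · calc A + H ⊆ ((a₁ +ᵥ H) ∪ (a₂ +ᵥ H)) + H := add_subset_add_right hAsub
        _ = (a₁ +ᵥ H) ∪ (a₂ +ᵥ H) := by rw [union_add, hH.coset_add, hH.coset_add]
        _ ⊆ rseq H r a₁ 2 := by
          refine union_subset ?_ ?_
          · have := coset_subset_rseq H r a₁ (i := 0) (n := 2) (by omega)
            rwa [zero_nsmul, add_zero] at this
          · have := coset_subset_rseq H r a₁ (i := 1) (n := 2) (by omega)
            rwa [one_nsmul, ← ha₂'] at this
    · intro x hx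
      rw [mem_rseq] at hx
      obtain ⟨i, hi, hxi⟩ := hx
      have hx1 := (hH.mem_coset_iff).1 hxi
      interval_cases i
      · rw [zero_nsmul, add_zero] at hx1
        exact mem_add.2 ⟨a₁, ha₁, x - a₁, hx1, by abel⟩
      · rw [one_nsmul, ← ha₂'] at hx1
        exact mem_add.2 ⟨a₂, ha₂, x - a₂, hx1, by abel⟩
  have ht2 : 2 ≤ t := by
    by_contra h
    have : t = 1 := by omega
    rw [this, one_nsmul] at htH
    exact hne (by rw [hH.mem_coset_iff, ← hr]; exact htH)
  have hcardAH : #(A + H) = 2 * #H := by rw [hAH]; exact card_rseq hH hmin a₁ ht2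
  have hnear : IsNearSeq H r A := by
    refine ⟨⟨a₁, 2, by omega, hAH⟩, ?_⟩
    have := card_sdiff_add_card_eq_card (hH.subset_add A)
    omega
  have huniv := card_univ_eq_of_minimal hH hgen ht htH hmin
  have hAc : #Aᶜ + #A = t * #H := by rw [← huniv, card_compl]; have := card_le_univ A; omega
  have hA2 : #A ≤ 2 * #H := by rw [← hcardAH]; exact card_le_card (hH.subset_add A)
  have ht4 : 4 * #H ≤ t * #H := by
    by_contra hlt
    have : t * #H ≤ 3 * #H := Nat.mul_le_mul_right _ (by
      by_contra h'; exact hlt (Nat.mul_le_mul_right _ (by omega)))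
    omega
  exact h8 H r hH hHu hgen hnear hHA (by omega)

/-- When the step theorem holds for a maximal supertrio `(A*,B*,C*)` of a critical trio
`(A, B', C')` all of whose members lie in no proper coset, `A` is a proper near sequence (Lemma 7.6)
— contradicting `NoProperNearSeq A`.  (The common end of Claim 10 and of the final step.)
[cite: BoothbyDevosMontejano2013, §8 (Claim 10; final step)] -/
theorem false_of_structure_supertrio {H' As Bs Cs B' C' : Finset G} (hH' : IsSubgroupCarrier H')
    (hH'u : H' ≠ univ)
    (hstr : IsPureBeat H' (As, Bs, Cs) ∨ IsPureChord H' (As, Bs, Cs) ∨ IsImpureBeat H' (As, Bs, Cs) ∨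
      IsImpureChord H' (As, Bs, Cs))
    (hmaxs : IsMaximalTrio As Bs Cs) (hA : A ⊆ As) (hB : B' ⊆ Bs) (hC : C' ⊆ Cs)
    (hδ : 0 < trioDeficiency A B' C') (h7A : InNoProperCoset A) (h7B : InNoProperCoset B')
    (h7C : InNoProperCoset C') (h8 : NoProperNearSeq A) : False := by
  have hcos : ¬ ∃ x : G, As ⊆ x +ᵥ H' ∨ Bs ⊆ x +ᵥ H' ∨ Cs ⊆ x +ᵥ H' := by
    rintro ⟨x, h | h | h⟩
    · exact h7A H' x hH' hH'u (hA.trans h)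
    · exact h7B H' x hH' hH'u (hB.trans h)
    · exact h7C H' x hH' hH'u (hC.trans h)
  rcases hstr with h | h | h | h
  · exact hcos h.exists_subset_coset
  · obtain ⟨r, hgen, ⟨hnear, hprop⟩, -, -⟩ := isNearSeq_of_subtrio_of_isPureChord hH' h hA hB hC hδ
    exact h8 H' r hH' hH'u hgen hnear (card_lt_of_isNearSeq hH' hH'u hgen hnear h7A) hprop
  · exact hcos h.exists_subset_coset
  · obtain ⟨r, hgen, ⟨hnear, hprop⟩, -, -⟩ :=
      isNearSeq_of_subtrio_of_isImpureChord hH' h hmaxs hA hB hC hδ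
    exact h8 H' r hH' hH'u hgen hnear (card_lt_of_isNearSeq hH' hH'u hgen hnear h7A) hprop

end Standing

/-! ## Claim 9 -/

section Claim9

variable [Fintype G] {H A D : Finset G}

/-- **Claim 9.**  "If `D ⊆ G` satisfies `(A,D)` critical and `|D| > ½|A|` then `[D] = G`" — for `A`
in no proper coset (Claim 7), not a proper near sequence (Claim 8), and with `3|A| ≤ |G| + 1` (which
holds in §8 since `δ = 1` and `|A| ≤ |B| ≤ |C|`).  Proof as printed: with `H` the closure of `D`,
`A + D` is `H`-quasiperiodic (Lemma 5.2); three `H`-cosets of `A` give `|A + D| ≥ 2|H| + |D| ≥ 3|D|`,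
one coset is excluded by Claim 7, and two cosets make `A` a near sequence (or give
`|A + D| ≥ |H| + |D|` when `|A| ≤ |H|`). [cite: BoothbyDevosMontejano2013, §8 (Claim 9); Lemma 5.2] -/
theorem inNoProperCoset_of_critical (hA : A.Nonempty) (h7 : InNoProperCoset A) (h8 : NoProperNearSeq A)
    (hAle : 3 * #A ≤ Fintype.card G + 1) (hD : D.Nonempty) (hcrit : #(A + D) < #A + #D)
    (h2D : #A < 2 * #D) : InNoProperCoset D := by
  intro H₁ x hH₁ hH₁u hDx
  obtain ⟨H, hH, hcl⟩ := exists_closureIs D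
  have hHH₁ : H ⊆ H₁ := hcl.subset hH hH₁ ⟨x, hDx⟩
  have hHu : H ≠ univ := fun h => hH₁u (univ_subset_iff.1 (h ▸ hHH₁))
  obtain ⟨d₀, hd₀⟩ := hD
  obtain ⟨d, hDd⟩ := hcl.1
  have hDd₀ : D ⊆ d₀ +ᵥ H := hH.subset_coset_of_mem hDd hd₀
  have hDH : #D ≤ #H := by have := card_le_card hDd₀; rwa [card_vadd_finset] at this
  obtain ⟨e, hquasi⟩ := exists_quasistable_of_critical hH hcl ⟨d₀, hd₀⟩ hA (by rwa [add_comm D A, add_comm #D])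
  rw [add_comm D A] at hquasi
  -- the translate `a + D` and its coset `(a + d₀) + H`
  have hP : ∀ a ∈ A, a +ᵥ D ⊆ A + D := fun a ha => vadd_finset_subset_add ha
  have hPQ : ∀ a : G, a +ᵥ D ⊆ (a + d₀) +ᵥ H := fun a => by
    rw [add_vadd]; exact vadd_finset_subset_vadd_finset hDd₀
  have hfull : ∀ a ∈ A, (a + d₀) +ᵥ H ≠ e +ᵥ H → (a + d₀) +ᵥ H ⊆ A + D := by
    intro a ha hne
    have had : a + d₀ ∈ (A + D) \ (e +ᵥ H) := by
      rw [mem_sdiff]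
      refine ⟨add_mem_add ha hd₀, fun h => hne (hH.coset_eq_of_mem h)⟩
    exact (hH.coset_subset_of_stable hquasi had).trans sdiff_subset
  have hdisj : ∀ a₁ a₂ : G, a₂ ∉ a₁ +ᵥ H → Disjoint ((a₁ + d₀) +ᵥ H) ((a₂ + d₀) +ᵥ H) := by
    intro a₁ a₂ hne
    rcases hH.coset_eq_or_disjoint (a₁ + d₀) (a₂ + d₀) with heq | hd
    · exfalso; apply hne
      have : a₂ + d₀ ∈ (a₁ + d₀) +ᵥ H := by rw [heq]; exact hH.mem_coset_self _
      rw [hH.mem_coset_iff] at this ⊢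
      have e : a₂ - a₁ = a₂ + d₀ - (a₁ + d₀) := by abel
      rwa [e]
    · exact hd
  have hsymm : ∀ a₁ a₂ : G, a₂ ∉ a₁ +ᵥ H → a₁ ∉ a₂ +ᵥ H := by
    intro a₁ a₂ h h'
    exact h (by rw [hH.coset_eq_of_mem h']; exact hH.mem_coset_self _)
  have hneE : ∀ a₁ a₂ : G, a₂ ∉ a₁ +ᵥ H → (a₁ + d₀) +ᵥ H = e +ᵥ H →
      (a₂ + d₀) +ᵥ H ≠ e +ᵥ H := by
    intro a₁ a₂ h12 hE1 hE2
    apply h12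
    have : a₂ + d₀ ∈ (a₁ + d₀) +ᵥ H := by rw [hE1, ← hE2]; exact hH.mem_coset_self _
    rw [hH.mem_coset_iff] at this ⊢
    have e : a₂ - a₁ = a₂ + d₀ - (a₁ + d₀) := by abel
    rwa [e]
  -- KEY: two full cosets and a third translate give `|A + D| ≥ 2|H| + |D|`, too big
  have key : ∀ b₁ b₂ b₃ : G, b₃ ∈ A → b₂ ∉ b₁ +ᵥ H → b₃ ∉ b₁ +ᵥ H → b₃ ∉ b₂ +ᵥ H →
      (b₁ + d₀) +ᵥ H ⊆ A + D → (b₂ + d₀) +ᵥ H ⊆ A + D → False := by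
    intro b₁ b₂ b₃ hb₃ h12 h13 h23 hf1 hf2
    have hsub : ((b₁ + d₀) +ᵥ H) ∪ ((b₂ + d₀) +ᵥ H) ∪ (b₃ +ᵥ D) ⊆ A + D :=
      union_subset (union_subset hf1 hf2) (hP b₃ hb₃)
    have h1 := card_le_card hsub
    have hd12 := hdisj b₁ b₂ h12
    have hd3 : Disjoint (((b₁ + d₀) +ᵥ H) ∪ ((b₂ + d₀) +ᵥ H)) (b₃ +ᵥ D) := by
      rw [disjoint_union_left]
      exact ⟨(hdisj b₁ b₃ h13).mono_right (hPQ b₃), (hdisj b₂ b₃ h23).mono_right (hPQ b₃)⟩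
    rw [card_union_of_disjoint hd3, card_union_of_disjoint hd12, card_vadd_finset, card_vadd_finset,
      card_vadd_finset] at h1
    omega
  obtain ⟨a₁, ha₁⟩ := hA
  by_cases hone : A ⊆ a₁ +ᵥ H
  · exact h7 H a₁ hH hHu hone
  obtain ⟨a₂, ha₂, ha₂1⟩ : ∃ a₂ ∈ A, a₂ ∉ a₁ +ᵥ H := by
    by_contra h; push Not at h; exact hone fun a ha => h a ha
  by_cases hthree : ∃ a₃ ∈ A, a₃ ∉ a₁ +ᵥ H ∧ a₃ ∉ a₂ +ᵥ H
  · obtain ⟨a₃, ha₃, h13, h23⟩ := hthree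
    by_cases hE1 : (a₁ + d₀) +ᵥ H = e +ᵥ H
    · -- then the cosets of `a₂`, `a₃` are full
      exact key a₂ a₃ a₁ ha₁ h23 (hsymm _ _ ha₂1) (hsymm _ _ h13)
        (hfull a₂ ha₂ (hneE a₁ a₂ ha₂1 hE1)) (hfull a₃ ha₃ (hneE a₁ a₃ h13 hE1))
    by_cases hE2 : (a₂ + d₀) +ᵥ H = e +ᵥ H
    · exact key a₁ a₃ a₂ ha₂ h13 ha₂1 (hsymm _ _ h23) (hfull a₁ ha₁ hE1)
        (hfull a₃ ha₃ (hneE a₂ a₃ h23 hE2))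
    exact key a₁ a₂ a₃ ha₃ ha₂1 h13 h23 (hfull a₁ ha₁ hE1) (hfull a₂ ha₂ hE2)
  -- exactly two cosets
  push Not at hthree
  have hAsub : A ⊆ (a₁ +ᵥ H) ∪ (a₂ +ᵥ H) := by
    intro a ha
    rw [mem_union]
    by_cases h : a ∈ a₁ +ᵥ H
    · exact Or.inl h
    · exact Or.inr (hthree a ha h)
  by_cases hAH : #A ≤ #H
  · -- one full coset and a translate of `D`
    have two : ∀ b₁ b₂ : G, b₂ ∈ A → b₂ ∉ b₁ +ᵥ H → (b₁ + d₀) +ᵥ H ⊆ A + D → False := by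
      intro b₁ b₂ hb₂ h12 hf1
      have hsub : ((b₁ + d₀) +ᵥ H) ∪ (b₂ +ᵥ D) ⊆ A + D := union_subset hf1 (hP b₂ hb₂)
      have h1 := card_le_card hsub
      rw [card_union_of_disjoint ((hdisj b₁ b₂ h12).mono_right (hPQ b₂)), card_vadd_finset,
        card_vadd_finset] at h1
      omega
    by_cases hE1 : (a₁ + d₀) +ᵥ H = e +ᵥ H
    · exact two a₂ a₁ ha₁ (hsymm _ _ ha₂1) (hfull a₂ ha₂ (hneE a₁ a₂ ha₂1 hE1))
    exact two a₁ a₂ ha₂ ha₂1 (hfull a₁ ha₁ hE1)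
  exact false_of_subset_two_cosets hH hHu ha₁ ha₂ ha₂1 hAsub (by omega) hAle h7 h8

end Claim9

/-! ## Claims 10 and 11 -/

section Claim10

variable [Fintype G] {H A B C D : Finset G}

/-- The shape in which the induction hypothesis of §8 is used (criterion 2, "`C̄` minimum"): the step
theorem holds for every maximal nontrivial critical trio whose third member is larger than `|C|`.
[cite: BoothbyDevosMontejano2013, §8] -/
def StepBelow (C : Finset G) : Prop :=
  ∀ A₁ B₁ C₁ : Finset G, IsMaximalTrio A₁ B₁ C₁ → 0 < trioDeficiency A₁ B₁ C₁ → A₁.Nonempty →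
    B₁.Nonempty → C₁.Nonempty → #C < #C₁ → ∃ H' : Finset G, IsSubgroupCarrier H' ∧ H' ≠ univ ∧
      (IsPureBeat H' (A₁, B₁, C₁) ∨ IsPureChord H' (A₁, B₁, C₁) ∨ IsImpureBeat H' (A₁, B₁, C₁) ∨
        IsImpureChord H' (A₁, B₁, C₁))

/-- Unfolding lemma. [cite: BoothbyDevosMontejano2013, §8] -/
theorem stepBelow_iff : StepBelow C ↔
    ∀ A₁ B₁ C₁ : Finset G, IsMaximalTrio A₁ B₁ C₁ → 0 < trioDeficiency A₁ B₁ C₁ → A₁.Nonempty →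
      B₁.Nonempty → C₁.Nonempty → #C < #C₁ → ∃ H' : Finset G, IsSubgroupCarrier H' ∧ H' ≠ univ ∧
        (IsPureBeat H' (A₁, B₁, C₁) ∨ IsPureChord H' (A₁, B₁, C₁) ∨ IsImpureBeat H' (A₁, B₁, C₁) ∨
          IsImpureChord H' (A₁, B₁, C₁)) := Iff.rfl

/-- In no proper coset ⇒ at least `|A| > 2|H|` when `(A,H)` is critical, unless `A` sits in two
cosets (then the two-coset argument applies): "`|A| + |H| > |A + H| ≥ 3|H|`".
[cite: BoothbyDevosMontejano2013, §8 (Claim 10)] -/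
theorem two_mul_card_lt_of_critical (hH : IsSubgroupCarrier H) (hHu : H ≠ univ) (hA : A.Nonempty)
    (hcritH : #(A + H) < #A + #H) (hAle : 3 * #A ≤ Fintype.card G + 1) (h7 : InNoProperCoset A)
    (h8 : NoProperNearSeq A) : 2 * #H < #A := by
  obtain ⟨a₁, ha₁⟩ := hA
  obtain ⟨a₂, ha₂, ha₂1⟩ : ∃ a₂ ∈ A, a₂ ∉ a₁ +ᵥ H := by
    by_contra h; push Not at h; exact h7 H a₁ hH hHu fun a ha => h a ha
  have hcos : ∀ a ∈ A, a +ᵥ H ⊆ A + H := fun a ha => vadd_finset_subset_add ha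
  have hdis : ∀ b₁ b₂ : G, b₂ ∉ b₁ +ᵥ H → Disjoint (b₁ +ᵥ H) (b₂ +ᵥ H) := by
    intro b₁ b₂ hne
    rcases hH.coset_eq_or_disjoint b₁ b₂ with heq | hd
    · exact absurd (by rw [heq]; exact hH.mem_coset_self _) hne
    · exact hd
  by_cases hthree : ∃ a₃ ∈ A, a₃ ∉ a₁ +ᵥ H ∧ a₃ ∉ a₂ +ᵥ H
  · obtain ⟨a₃, ha₃, h13, h23⟩ := hthree
    have hsub : (a₁ +ᵥ H) ∪ (a₂ +ᵥ H) ∪ (a₃ +ᵥ H) ⊆ A + H :=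
      union_subset (union_subset (hcos a₁ ha₁) (hcos a₂ ha₂)) (hcos a₃ ha₃)
    have h1 := card_le_card hsub
    have hd3 : Disjoint ((a₁ +ᵥ H) ∪ (a₂ +ᵥ H)) (a₃ +ᵥ H) := by
      rw [disjoint_union_left]; exact ⟨hdis a₁ a₃ h13, hdis a₂ a₃ h23⟩
    rw [card_union_of_disjoint hd3, card_union_of_disjoint (hdis a₁ a₂ ha₂1), card_vadd_finset,
      card_vadd_finset, card_vadd_finset] at h1
    omega
  · exfalso
    push Not at hthree
    have hAsub : A ⊆ (a₁ +ᵥ H) ∪ (a₂ +ᵥ H) := by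
      intro a ha
      rw [mem_union]
      by_cases h : a ∈ a₁ +ᵥ H
      · exact Or.inl h
      · exact Or.inr (hthree a ha h)
    have hsub : (a₁ +ᵥ H) ∪ (a₂ +ᵥ H) ⊆ A + H := union_subset (hcos a₁ ha₁) (hcos a₂ ha₂)
    have h1 := card_le_card hsub
    rw [card_union_of_disjoint (hdis a₁ a₂ ha₂1), card_vadd_finset, card_vadd_finset] at h1
    exact false_of_subset_two_cosets hH hHu ha₁ ha₂ ha₂1 hAsub (by omega) hAle h7 h8

/-- **Claim 10.**  "There does not exist a nontrivial subgroup `H < G` so that `(A,H)` is critical"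
— for the minimal counterexample of §8: `(A,B,C)` maximal nontrivial critical with `|A| ≤ |B|`,
`3|A| ≤ |G| + 1`, trivial stabiliser (Claim 6), `A`, `C` in no proper coset (Claim 7), `A` not a
proper near sequence (Claim 8), and the step theorem known for trios with a larger third member.
Proof as printed: a partial `H`-coset `R` of `C`; purification `C' = C ∪ R`, `B' = B ∩ third A R`;
`|B'| > |B| − |H| ≥ |A| − |H| ≥ ½|A|`; Claim 9 gives `[B'] = G`; a maximal supertrio of `(A,B',C')` is
a chord by the hypothesis, so `A` is a proper near sequence by Lemma 7.6 — contradiction.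
[cite: BoothbyDevosMontejano2013, §8 (Claim 10)] -/
theorem not_critical_subgroup (hmax : IsMaximalTrio A B C) (hδ : 0 < trioDeficiency A B C)
    (hA : A.Nonempty) (hC : C.Nonempty) (hAB : #A ≤ #B)
    (hAle : 3 * #A ≤ Fintype.card G + 1) (h6 : C.addStab = {0}) (h7A : InNoProperCoset A)
    (h7C : InNoProperCoset C) (h8 : NoProperNearSeq A) (ih : StepBelow C)
    (hH : IsSubgroupCarrier H) (hH0 : H ≠ {0}) (hHu : H ≠ univ) (hcritH : #(A + H) < #A + #H) :
    False := by
  -- a partial `H`-coset of `C`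
  obtain ⟨c, hc, hcH⟩ : ∃ c ∈ C, ¬ c +ᵥ H ⊆ C := by
    by_contra hall
    push Not at hall
    have hCH : C + H = C := by
      refine Subset.antisymm ?_ (hH.subset_add C)
      intro x hx
      obtain ⟨c, hc, h, hh, rfl⟩ := mem_add.1 hx
      exact hall c hc (mem_vadd_finset.2 ⟨h, hh, rfl⟩)
    have hsub := (hH.add_eq_self_iff_subset_addStab hC).1 hCH
    rw [h6] at hsub
    exact hH0 (Subset.antisymm hsub (singleton_subset_iff.2 hH.zero_mem))
  have h2H : 2 * #H < #A := two_mul_card_lt_of_critical hH hHu hA hcritH hAle h7A h8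
  -- purification with the roles of `B` and `C` exchanged
  have hpur := (hmax.1.swap_right).trioDeficiency_le_purify hA hH hcritH c
    ⟨c, mem_inter.2 ⟨hc, hH.mem_coset_self c⟩⟩
  rw [trioDeficiency_swap_right A B C,
    trioDeficiency_swap_right A (B ∩ third A (c +ᵥ H)) (C ∪ (c +ᵥ H))] at hpur
  have htrio' : IsTrio A (B ∩ third A (c +ᵥ H)) (C ∪ (c +ᵥ H)) :=
    ((hmax.1.swap_right).union_inter (c +ᵥ H)).swap_right
  have hδ' : 0 < trioDeficiency A (B ∩ third A (c +ᵥ H)) (C ∪ (c +ᵥ H)) := lt_of_lt_of_le hδ hpur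
  -- counting: `|B'| ≥ |B| − |H| + 1`
  have hC'le : #(C ∪ (c +ᵥ H)) + 1 ≤ #C + #H := by
    have h1 := card_union_add_card_inter C (c +ᵥ H)
    have h2 : 1 ≤ #(C ∩ (c +ᵥ H)) := card_pos.2 ⟨c, mem_inter.2 ⟨hc, hH.mem_coset_self c⟩⟩
    rw [card_vadd_finset] at h1
    omega
  have hB'ge : #B + 1 ≤ #(B ∩ third A (c +ᵥ H)) + #H := by
    unfold trioDeficiency at hpur; omega
  have h2B' : #A < 2 * #(B ∩ third A (c +ᵥ H)) := by omega
  have hB'ne : (B ∩ third A (c +ᵥ H)).Nonempty := card_pos.1 (by omega)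
  have hcrit' := htrio'.card_add_lt hδ'
  have h7B' : InNoProperCoset (B ∩ third A (c +ᵥ H)) :=
    inNoProperCoset_of_critical hA h7A h8 hAle hB'ne hcrit' h2B'
  have h7C' : InNoProperCoset (C ∪ (c +ᵥ H)) := h7C.mono subset_union_left
  -- a maximal supertrio of the purified trio
  obtain ⟨As, Bs, Cs, hAs, hBs, hCs, hmaxs⟩ := htrio'.exists_maximal
  have hδs : 0 < trioDeficiency As Bs Cs := lt_of_lt_of_le hδ' (trioDeficiency_mono hAs hBs hCs)
  have hClt : #C < #Cs := by
    refine lt_of_lt_of_le ?_ (card_le_card hCs)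
    apply card_lt_card
    refine ⟨subset_union_left, fun h => hcH ((subset_union_right).trans h)⟩
  obtain ⟨H', hH', hH'u, hstr⟩ := ih As Bs Cs hmaxs hδs (hA.mono hAs) (hB'ne.mono hBs)
    ((hC.mono subset_union_left).mono hCs) hClt
  exact false_of_structure_supertrio hH' hH'u hstr hmaxs hAs hBs hCs hδ' h7A h7B' h7C' h8

/-- **Claim 11, first half** ("`δ(A,D) = 1`" for every nontrivial critical `(A,D)`), in the form
`setDeficiency A ≤ 1`: by Mann's theorem the maximal deficiency is attained at a subgroup `H`,
which by Claim 10 must be trivial. [cite: BoothbyDevosMontejano2013, §8 (Claim 11); Thm 6.1] -/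
theorem setDeficiency_le_one (hA : A.Nonempty) (hAu : A ≠ univ)
    (h10 : ∀ H : Finset G, IsSubgroupCarrier H → H ≠ {0} → H ≠ univ → ¬ #(A + H) < #A + #H) :
    setDeficiency A ≤ 1 := by
  obtain ⟨H, hH, hAHu, heq⟩ := exists_subgroupCarrier_setDeficiency_eq hA hAu
  by_contra h2
  have hHu : H ≠ univ := by
    rintro rfl
    apply hAHu
    obtain ⟨a, ha⟩ := hA
    exact eq_univ_of_forall fun x => mem_add.2 ⟨a, ha, -a + x, mem_univ _, by abel⟩
  have hH0 : H ≠ {0} := by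
    rintro rfl
    rw [singleton_zero, add_zero, Finset.card_zero] at heq
    omega
  exact h10 H hH hH0 hHu (by omega)

/-- **Claim 11, second half**: "either `|D| = 1` or `[D] = G`" — a set `D` with `|D| ≥ 2` and
`(A,D)` critical lies in no proper coset (Lemma 5.2 would make `(A, closure of D)` critical,
contradicting Claim 10). [cite: BoothbyDevosMontejano2013, §8 (Claim 11); Lemma 5.2] -/
theorem inNoProperCoset_of_critical_of_two_le (hA : A.Nonempty)
    (h10 : ∀ H : Finset G, IsSubgroupCarrier H → H ≠ {0} → H ≠ univ → ¬ #(A + H) < #A + #H)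
    (h2 : 2 ≤ #D) (hcrit : #(A + D) < #A + #D) : InNoProperCoset D := by
  intro H₁ x hH₁ hH₁u hDx
  obtain ⟨H, hH, hcl⟩ := exists_closureIs D
  have hHH₁ : H ⊆ H₁ := hcl.subset hH hH₁ ⟨x, hDx⟩
  have hHu : H ≠ univ := fun h => hH₁u (univ_subset_iff.1 (h ▸ hHH₁))
  have hD : D.Nonempty := card_pos.1 (by omega)
  obtain ⟨d, hDd⟩ := hcl.1
  have hH0 : H ≠ {0} := by
    rintro rfl
    have := card_le_card hDd
    rw [card_vadd_finset, card_singleton] at this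
    omega
  have h52 := card_add_card_add_le_of_critical hH hcl hD hA (by rwa [add_comm D A, add_comm #D])
  rw [add_comm D A, add_comm H A] at h52
  exact h10 H hH hH0 hHu (by omega)

end Claim10

/-! ## The step for trivial stabiliser (Claims 6–12 and the final argument, modulo the quotient) -/

section Step

variable [Fintype G] {A B C : Finset G}

/-- **Kemperman's theorem, one step, for trivial stabiliser** — §8 of the paper after Claim 6:
let `(A,B,C)` be a maximal nontrivial critical trio with `|A| ≤ |B| ≤ |C|` and `stab(A) = {0}`, and
suppose the step theorem holds for all maximal nontrivial critical trios of `G` with a larger third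
member (criterion 2 of the minimal counterexample).  Then `(A,B,C)` is a pure beat, a pure chord, an
impure beat or an impure chord relative to some proper subgroup `H < G`.  Proof as printed: Claim 7
(a member in a proper coset ⇒ beat, Lemma 5.3), Claim 8 (a proper near sequence ⇒ chord,
Lemma 7.5); otherwise Claims 9–12 and the final doubling argument `B' = B ∩ (g + B)`,
`C' = C ∪ (C − g)` produce, via the hypothesis and Lemma 7.6, a proper near sequence — contradiction.
What remains for Theorem 4.5 is Claim 6 (passing to `G / stab(A)`), an induction over all finite
abelian groups. [cite: BoothbyDevosMontejano2013, §8; Thm 4.5] -/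
theorem kemperman_step_of_addStab_eq_singleton (hmax : IsMaximalTrio A B C)
    (hδ : 0 < trioDeficiency A B C) (hA : A.Nonempty) (hB : B.Nonempty) (hC : C.Nonempty)
    (hAB : #A ≤ #B) (hBC : #B ≤ #C) (h6 : A.addStab = {0}) (ih : StepBelow C) :
    ∃ H : Finset G, IsSubgroupCarrier H ∧ H ≠ univ ∧
      (IsPureBeat H (A, B, C) ∨ IsPureChord H (A, B, C) ∨ IsImpureBeat H (A, B, C) ∨
        IsImpureChord H (A, B, C)) := by
  classical
  -- CLAIM 7
  by_cases h7 : ∃ (H : Finset G) (x : G), IsSubgroupCarrier H ∧ H ≠ univ ∧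
      (A ⊆ x +ᵥ H ∨ B ⊆ x +ᵥ H ∨ C ⊆ x +ᵥ H)
  · obtain ⟨H, x, hH, hHu, hABC⟩ := h7
    rcases hABC with hX | hX | hX
    · obtain ⟨H₀, hH₀, hcl⟩ := exists_closureIs A
      have hH₀u : H₀ ≠ univ := fun h => hHu (univ_subset_iff.1 (h ▸ hcl.subset hH₀ hH ⟨x, hX⟩))
      obtain ⟨a, ha⟩ := hcl.1
      refine ⟨H₀, hH₀, hH₀u, ?_⟩
      rcases hmax.isPureBeat_or_isImpureBeat_of_subset_coset hδ hA hB hC hH₀ hcl ha with h | h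
      · exact Or.inl h
      · exact Or.inr (Or.inr (Or.inl h))
    · obtain ⟨H₀, hH₀, hcl⟩ := exists_closureIs B
      have hH₀u : H₀ ≠ univ := fun h => hHu (univ_subset_iff.1 (h ▸ hcl.subset hH₀ hH ⟨x, hX⟩))
      obtain ⟨a, ha⟩ := hcl.1
      refine ⟨H₀, hH₀, hH₀u, ?_⟩
      have hsim : Similar (B, A, C) (A, B, C) := (Similar.refl (B, A, C)).swap
      have hδ' : 0 < trioDeficiency B A C := by rwa [trioDeficiency_swap]
      rcases hmax.swap.isPureBeat_or_isImpureBeat_of_subset_coset hδ' hB hA hC hH₀ hcl ha with h | h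
      · exact Or.inl (h.similar hsim)
      · exact Or.inr (Or.inr (Or.inl (h.similar hsim)))
    · obtain ⟨H₀, hH₀, hcl⟩ := exists_closureIs C
      have hH₀u : H₀ ≠ univ := fun h => hHu (univ_subset_iff.1 (h ▸ hcl.subset hH₀ hH ⟨x, hX⟩))
      obtain ⟨a, ha⟩ := hcl.1
      refine ⟨H₀, hH₀, hH₀u, ?_⟩
      have hsim : Similar (C, A, B) (A, B, C) := (Similar.refl (C, A, B)).rotate
      have hδ' : 0 < trioDeficiency C A B := by rwa [trioDeficiency_rotate, trioDeficiency_rotate]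
      rcases hmax.rotate.rotate.isPureBeat_or_isImpureBeat_of_subset_coset hδ' hC hA hB hH₀ hcl ha
        with h | h
      · exact Or.inl (h.similar hsim)
      · exact Or.inr (Or.inr (Or.inl (h.similar hsim)))
  push Not at h7
  have h7A : InNoProperCoset A := fun H x hH hHu => (h7 H x hH hHu).1
  have h7B : InNoProperCoset B := fun H x hH hHu => (h7 H x hH hHu).2.1
  have h7C : InNoProperCoset C := fun H x hH hHu => (h7 H x hH hHu).2.2
  -- CLAIM 8
  by_cases h8 : ∃ (H : Finset G) (r : G), IsSubgroupCarrier H ∧ H ≠ univ ∧ IsCyclicQuotGen H r ∧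
      IsNearSeq H r A ∧ #H < #A ∧ 2 * #H ≤ #Aᶜ
  · obtain ⟨H, r, hH, hHu, hgen, hnear, hHA, hprop⟩ := h8
    refine ⟨H, hH, hHu, ?_⟩
    rcases hmax.isPureChord_or_isImpureChord_of_isNearSeq hH hgen hnear hHA hprop hδ
      (fun c => h7B H c hH hHu) (fun c => h7C H c hH hHu) with h | h
    · exact Or.inr (Or.inl h)
    · exact Or.inr (Or.inr (Or.inr h))
  exfalso
  have h8' : NoProperNearSeq A := fun H r hH hHu hgen hn hlt hp => h8 ⟨H, r, hH, hHu, hgen, hn, hlt, hp⟩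
  -- δ = 1 (Claim 6) and its numerical consequences
  have hstab := hmax.addStab_eq hA hB hC
  have hC6 : C.addStab = {0} := by rw [← hstab.2, ← hstab.1, h6]
  have hδ1 : trioDeficiency A B C = 1 := by
    rw [hmax.trioDeficiency_eq_card_addStab' hA hB hδ, h6, card_singleton]; rfl
  have hsum : #A + #B + #C = Fintype.card G + 1 := by
    unfold trioDeficiency at hδ1; omega
  have hAle : 3 * #A ≤ Fintype.card G + 1 := by omega
  have hApos := hA.card_pos
  have hAu : A ≠ univ := by
    intro h; rw [h, card_univ] at hAle; have := hB.card_pos; have := hC.card_pos; omega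
  have hzero : IsSubgroupCarrier ({0} : Finset G) := by rw [← h6]; exact IsSubgroupCarrier.of_addStab hA
  have hzu : ({0} : Finset G) ≠ univ := by
    intro h
    have := congrArg Finset.card h
    rw [card_singleton, card_univ] at this
    omega
  -- |A| ≥ 3
  have hA3 : 3 ≤ #A := by
    by_contra hlt
    obtain ⟨a₁, ha₁⟩ := hA
    by_cases h1 : A ⊆ a₁ +ᵥ ({0} : Finset G)
    · exact h7A {0} a₁ hzero hzu h1
    obtain ⟨a₂, ha₂, ha₂1⟩ : ∃ a₂ ∈ A, a₂ ∉ a₁ +ᵥ ({0} : Finset G) := by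
      by_contra h; push Not at h; exact h1 fun a ha => h a ha
    have hAsub : A ⊆ (a₁ +ᵥ ({0} : Finset G)) ∪ (a₂ +ᵥ ({0} : Finset G)) := by
      have h2 : #A ≤ #({a₁, a₂} : Finset G) := by
        rw [card_pair (fun h => ha₂1 (by rw [← h]; exact hzero.mem_coset_self a₁))]; omega
      have := eq_of_subset_of_card_le (insert_subset_iff.2 ⟨ha₁, singleton_subset_iff.2 ha₂⟩) h2
      intro a ha
      rw [← this, mem_insert, mem_singleton] at ha
      rcases ha with rfl | rfl
      · exact mem_union_left _ (hzero.mem_coset_self _)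
      · exact mem_union_right _ (hzero.mem_coset_self _)
    have hHA : #({0} : Finset G) < #A := by
      rw [card_singleton]
      have : ({a₁, a₂} : Finset G) ⊆ A := insert_subset_iff.2 ⟨ha₁, singleton_subset_iff.2 ha₂⟩
      have h2 := card_le_card this
      rw [card_pair (fun h => ha₂1 (by rw [← h]; exact hzero.mem_coset_self a₁))] at h2
      omega
    exact false_of_subset_two_cosets hzero hzu ha₁ ha₂ ha₂1 hAsub hHA hAle h7A h8'
  -- CLAIM 10 packaged, CLAIM 11
  have h10 : ∀ H : Finset G, IsSubgroupCarrier H → H ≠ {0} → H ≠ univ → ¬ #(A + H) < #A + #H :=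
    fun H hH hH0 hHu hcr =>
      not_critical_subgroup hmax hδ hA hC hAB hAle hC6 h7A h7C h8' ih hH hH0 hHu hcr
  have hsd : setDeficiency A ≤ 1 := setDeficiency_le_one hA hAu h10
  -- CLAIM 12 and the final doubling argument
  obtain ⟨g, hg0, hg2⟩ := exists_two_le_card_inter_vadd (hmax.1.card_add_lt hδ) hA3 hAB
  have htr : IsTrio A (g +ᵥ B) (-g +ᵥ C) := hmax.1.translate_right g
  have hthC : -g +ᵥ C ⊆ third A (g +ᵥ B) := isTrio_iff_subset_third.1 htr
  have htrio' : IsTrio A (B ∩ (g +ᵥ B)) (C ∪ (-g +ᵥ C)) :=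
    (hmax.1.inter_union (g +ᵥ B)).mono Subset.rfl Subset.rfl (union_subset_union Subset.rfl hthC)
  have htrio'' : IsTrio A (B ∪ (g +ᵥ B)) (C ∩ (-g +ᵥ C)) :=
    (hmax.1.union_inter (g +ᵥ B)).mono Subset.rfl Subset.rfl (inter_subset_inter Subset.rfl hthC)
  have hbook := trioDeficiency_union_inter_add A B C (g +ᵥ B) (-g +ᵥ C)
  have hδtr : trioDeficiency A (g +ᵥ B) (-g +ᵥ C) = trioDeficiency A B C := by
    unfold trioDeficiency; rw [card_vadd_finset, card_vadd_finset]
  rw [hδtr, hδ1] at hbook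
  have hB'ne : (B ∩ (g +ᵥ B)).Nonempty := card_pos.1 (by omega)
  have hC'ne : (C ∪ (-g +ᵥ C)).Nonempty := hC.mono subset_union_left
  have hδ'le : trioDeficiency A (B ∩ (g +ᵥ B)) (C ∪ (-g +ᵥ C)) ≤ 1 := by
    have h1 := htrio'.trioDeficiency_le
    have h2 := card_add_card_le_setDeficiency (A := A) hB'ne (htrio'.add_ne_univ hC'ne)
    omega
  by_cases hC''e : C ∩ (-g +ᵥ C) = ∅
  · -- `C''` empty: then `δ' > δ`, contradicting `δ' ≤ 1`
    have hdis : Disjoint C (-g +ᵥ C) := disjoint_iff_inter_eq_empty.2 hC''e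
    have hC' : #(C ∪ (-g +ᵥ C)) = #C + #C := by rw [card_union_of_disjoint hdis, card_vadd_finset]
    have : (2 : ℤ) ≤ trioDeficiency A (B ∩ (g +ᵥ B)) (C ∪ (-g +ᵥ C)) := by
      unfold trioDeficiency at hδ1 ⊢; rw [hC']; push_cast; omega
    omega
  have hC''ne : (C ∩ (-g +ᵥ C)).Nonempty := nonempty_iff_ne_empty.2 hC''e
  have hB''ne : (B ∪ (g +ᵥ B)).Nonempty := hB.mono subset_union_left
  have hδ''le : trioDeficiency A (B ∪ (g +ᵥ B)) (C ∩ (-g +ᵥ C)) ≤ 1 := by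
    have h1 := htrio''.trioDeficiency_le
    have h2 := card_add_card_le_setDeficiency (A := A) hB''ne (htrio''.add_ne_univ hC''ne)
    omega
  have hδ' : 0 < trioDeficiency A (B ∩ (g +ᵥ B)) (C ∪ (-g +ᵥ C)) := by omega
  have hcrit' := htrio'.card_add_lt hδ'
  have h7B' : InNoProperCoset (B ∩ (g +ᵥ B)) :=
    inNoProperCoset_of_critical_of_two_le hA h10 hg2 hcrit'
  have h7C' : InNoProperCoset (C ∪ (-g +ᵥ C)) := h7C.mono subset_union_left
  obtain ⟨As, Bs, Cs, hAs, hBs, hCs, hmaxs⟩ := htrio'.exists_maximal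
  have hδs : 0 < trioDeficiency As Bs Cs := lt_of_lt_of_le hδ' (trioDeficiency_mono hAs hBs hCs)
  have hClt : #C < #Cs := by
    refine lt_of_lt_of_le ?_ (card_le_card hCs)
    apply card_lt_card
    refine ⟨subset_union_left, fun h => hg0 ?_⟩
    have hsub : -g +ᵥ C ⊆ C := subset_union_right.trans h
    have hmem : -g ∈ C.addStab := (mem_addStab_iff_vadd_finset_subset hC).2 hsub
    rw [hC6, mem_singleton, neg_eq_zero] at hmem
    exact hmem
  obtain ⟨H', hH', hH'u, hstr⟩ := ih As Bs Cs hmaxs hδs (hA.mono hAs) (hB'ne.mono hBs)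
    (hC'ne.mono hCs) hClt
  exact false_of_structure_supertrio hH' hH'u hstr hmaxs hAs hBs hCs hδ' h7A h7B' h7C' h8'

end Step

end Literature.Combinatorics.Additive
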